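import Summits.PneNP.PneNP.Theorems.ChebyshevTracialDesignRisingVandermonde
import Summits.PneNP.PneNP.Theorems.ChebyshevTracialDesignDipoleSquareSum
import HarnessLib

/-!
# Cell pnp-psdrank, route `ChebyshevTracialDesign`: the closed form (S) of the dipole norm
# `Σ_{d even} C(2κ,d)·pm(2κ−d)·pm(d)²·pm(n−2κ−d) = pm(2κ)·pm(n−4κ)·Π_{i<κ}(n−2κ−2i)`

Harmonic backbone of the `r = 1` rung of the crux `TracialDecayExp20` (stmt-PneNP-19878): the one identity to which prover g5
reduced (R3) (MEMO-7 §E; checked exactly on 1330 cases there). With `pm(2m) = 2^m·Π_{i<m}(1/2+i)` and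
`C(2κ,2j)·Π_{i<κ−j}(1/2+i)·Π_{i<j}(1/2+i) = C(κ,j)·Π_{i<κ}(1/2+i)` (prover's `…RisingVandermonde`, p446892) the left side is
`2^{n/2}·Π_{i<κ}(1/2+i)·Π_{i<n/2−2κ}(1/2+i)·Σ_j C(κ,j)·Π_{i<j}(1/2+i)·Π_{i<κ−j}(n/2−2κ+1/2+i)`, and the CHU–VANDERMONDE identity
for rising factorials (`rising_vandermonde` at `x = 1/2`, `y = n/2−2κ+1/2`) evaluates the sum to `Π_{i<κ}(n/2−2κ+1+i) = Π_{i<κ}(n/2−κ−i)`: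
* `sum_even_block_pmCount_eq` : (S), for even `n` and `4κ ≤ n`, in the `if Even d` shape of `…DipoleSquareSum.sum_sq_dipoleFunctional`;
* `sum_sq_dipoleFunctional_closed` : hence the matching-side norm of the dipole product in closed form,
  `Σ_{M} (Σ_{T : #{x∈T : partner x∈T} = 2κ} χ_T)² = 4^κ · pm(2κ) · pm(n−4κ) · Π_{i<κ}(n−2κ−2i)`
  (e.g. `κ = 1`, `n = 10`: `4·1·15·8 = 480`).
With the prover's `kernelEigen_tight_even_eq` (p444684) this gives the even tight eigenvalues in PRODUCT form and the monotone decay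
`λ_{2κ+2}/λ_{2κ} < (2κ+1)/(n−2κ)` of MEMO-7 §E (P) — the next file. [cite: GodsilMeagher2015, §15.2 (perfect matching scheme)]
WHAT THIS IS NOT: not (P) itself, not the σ₂ tail bound; nothing on psd rank. Supports crux stmt-PneNP-19878.
-/

set_option linter.dupNamespace false -- `Summit.PneNP.PneNP.…`: summit = sub-problem (D-0017)

noncomputable section

namespace Summit.PneNP.PneNP.Theorems.ChebyshevTracialDesignDipoleNormClosedForm

open Finset Literature.Barriers.PneNP Literature.Combinatorics.AssociationSchemes
open Literature.Combinatorics.AssociationSchemes.JohnsonSpectrum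
open Summit.PneNP.PneNP.Theorems.ChebyshevTracialDesignClosedPairCount
open Summit.PneNP.PneNP.Theorems.ChebyshevTracialDesignRisingVandermonde
open Summit.PneNP.PneNP.Theorems.ChebyshevTracialDesignDipoleSquareSum

/-! ### §1 The identity (S) -/

/-- Re-indexing the even summands: `Σ_{d ≤ 2κ} [d even]·f(d) = Σ_{j ≤ κ} f(2j)`. [folklore] -/
theorem sum_range_even_eq (κ : ℕ) (f : ℕ → ℝ) :
    ∑ d ∈ range (2 * κ + 1), (if Even d then f d else 0) = ∑ j ∈ range (κ + 1), f (2 * j) := by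
  rw [← sum_filter]
  symm
  refine sum_nbij' (fun j => 2 * j) (fun d => d / 2) (fun j hj => ?_) (fun d hd => ?_) (fun j _ => by omega)
    (fun d hd => ?_) (fun j _ => rfl)
  · have := mem_range.1 hj
    exact mem_filter.2 ⟨mem_range.2 (by omega), even_two_mul j⟩
  · obtain ⟨hd1, hd2⟩ := mem_filter.1 hd
    have := mem_range.1 hd1
    exact mem_range.2 (by omega)
  · obtain ⟨-, ⟨r, hr⟩⟩ := mem_filter.1 hd
    omega

/-- **(S), the closed form of the dipole norm.** For even `n` and `4κ ≤ n`:
`Σ_{d ≤ 2κ, d even} C(2κ,d)·pm(2κ−d)·pm(d)²·pm(n−2κ−d) = pm(2κ)·pm(n−4κ)·Π_{i<κ}(n−2κ−2i)`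
(Chu–Vandermonde for rising factorials at `x = 1/2`). [cite: GodsilMeagher2015, §15.2] -/
theorem sum_even_block_pmCount_eq {n κ : ℕ} (hn : Even n) (hκ : 4 * κ ≤ n) :
    ∑ d ∈ range (2 * κ + 1), (if Even d then
        (((2 * κ).choose d : ℕ) : ℝ) * pmCount (2 * κ - d) * (pmCount d : ℝ) ^ 2 * pmCount (n - 2 * κ - d) else 0) =
      (pmCount (2 * κ) : ℝ) * pmCount (n - 4 * κ) * ∏ i ∈ range κ, ((n : ℝ) - 2 * κ - 2 * i) := by
  obtain ⟨N, hN⟩ := hn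
  have hnN : n = 2 * N := by omega
  subst hnN
  have hκN : 2 * κ ≤ N := by omega
  -- rising factorials at 1/2
  set R : ℕ → ℝ := fun m => ∏ i ∈ range m, ((1 : ℝ) / 2 + i) with hR
  have hRpos : ∀ m, 0 < R m := fun m => prod_pos fun i _ => by positivity
  rw [sum_range_even_eq]
  -- each summand in rising-factorial form
  have hterm : ∀ j ∈ range (κ + 1),
      (((2 * κ).choose (2 * j) : ℕ) : ℝ) * pmCount (2 * κ - 2 * j) * (pmCount (2 * j) : ℝ) ^ 2 * pmCount (2 * N - 2 * κ - 2 * j) =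
        (2 : ℝ) ^ N * R κ * ((κ.choose j : ℝ) * R j * R (N - κ - j)) := by
    intro j hj
    have hjκ : j ≤ κ := by have := mem_range.1 hj; omega
    rw [show 2 * κ - 2 * j = 2 * (κ - j) by omega, show 2 * N - 2 * κ - 2 * j = 2 * (N - κ - j) by omega,
      pmCount_two_mul_eq_rising, pmCount_two_mul_eq_rising, pmCount_two_mul_eq_rising]
    have hc := choose_two_mul_rising hjκ
    simp only [hR]
    have hpow : (2 : ℝ) ^ (κ - j) * ((2 : ℝ) ^ j) ^ 2 * (2 : ℝ) ^ (N - κ - j) = (2 : ℝ) ^ N := by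
      rw [← pow_mul, ← pow_add, ← pow_add]
      congr 1
      omega
    calc (((2 * κ).choose (2 * j) : ℕ) : ℝ) * ((2 : ℝ) ^ (κ - j) * ∏ i ∈ range (κ - j), ((1 : ℝ) / 2 + i)) *
          ((2 : ℝ) ^ j * ∏ i ∈ range j, ((1 : ℝ) / 2 + i)) ^ 2 * ((2 : ℝ) ^ (N - κ - j) * ∏ i ∈ range (N - κ - j), ((1 : ℝ) / 2 + i))
        = ((2 : ℝ) ^ (κ - j) * ((2 : ℝ) ^ j) ^ 2 * (2 : ℝ) ^ (N - κ - j)) *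
          ((((2 * κ).choose (2 * j) : ℕ) : ℝ) * (∏ i ∈ range (κ - j), ((1 : ℝ) / 2 + i)) * ∏ i ∈ range j, ((1 : ℝ) / 2 + i)) *
          ((∏ i ∈ range j, ((1 : ℝ) / 2 + i)) * ∏ i ∈ range (N - κ - j), ((1 : ℝ) / 2 + i)) := by ring
      _ = (2 : ℝ) ^ N * ((κ.choose j : ℝ) * ∏ i ∈ range κ, ((1 : ℝ) / 2 + i)) *
          ((∏ i ∈ range j, ((1 : ℝ) / 2 + i)) * ∏ i ∈ range (N - κ - j), ((1 : ℝ) / 2 + i)) := by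
            rw [hpow]
            norm_cast at hc ⊢
            rw [hc]
      _ = _ := by ring
  rw [sum_congr rfl hterm, ← mul_sum,
    show (2 : ℝ) ^ N = 2 ^ κ * 2 ^ κ * 2 ^ (N - 2 * κ) by rw [← pow_add, ← pow_add]; congr 1; omega]
  -- split `R (N-κ-j) = R (N-2κ) · Π_{i<κ-j} (1/2 + (N-2κ) + i)` and apply the rising Vandermonde identity
  have hsplit : ∀ j ∈ range (κ + 1), (κ.choose j : ℝ) * R j * R (N - κ - j) =
      R (N - 2 * κ) * ((κ.choose j : ℝ) * (∏ i ∈ range j, ((1 : ℝ) / 2 + i)) *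
        ∏ i ∈ range (κ - j), (((1 : ℝ) / 2 + ((N - 2 * κ : ℕ) : ℝ)) + i)) := by
    intro j hj
    have hjκ : j ≤ κ := by have := mem_range.1 hj; omega
    simp only [hR]
    rw [show N - κ - j = (N - 2 * κ) + (κ - j) by omega, rising_split]
    ring
  rw [sum_congr rfl hsplit, ← mul_sum, rising_vandermonde ((1 : ℝ) / 2) ((1 : ℝ) / 2 + ((N - 2 * κ : ℕ) : ℝ)) κ]
  -- the right-hand side
  rw [show 2 * N - 4 * κ = 2 * (N - 2 * κ) by omega, pmCount_two_mul_eq_rising, pmCount_two_mul_eq_rising]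
  have hprod : ∏ i ∈ range κ, (((2 * N : ℕ) : ℝ) - 2 * κ - 2 * i) = (2 : ℝ) ^ κ * ∏ i ∈ range κ, ((1 : ℝ) / 2 + ((1 : ℝ) / 2 + ((N - 2 * κ : ℕ) : ℝ)) + i) := by
    rw [← prod_range_reflect (fun i => ((1 : ℝ) / 2 + ((1 : ℝ) / 2 + ((N - 2 * κ : ℕ) : ℝ)) + i)) κ]
    rw [show (2 : ℝ) ^ κ = ∏ i ∈ range κ, (2 : ℝ) by simp, ← prod_mul_distrib]
    refine prod_congr rfl fun i hi => ?_
    have hi' := mem_range.1 hi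
    push_cast [show 2 * κ ≤ N by omega, show i ≤ κ - 1 by omega, show 1 ≤ κ by omega]
    ring
  rw [hprod]
  simp only [hR]
  ring

/-! ### §2 The dipole norm in closed form -/

variable {n κ : ℕ} {a b : Fin (2 * κ) → Fin n}

/-- **The matching-side norm of the dipole product, closed form**: for even `n`, `4κ ≤ n` and injective disjoint dipoles
`a, b : Fin (2κ) → Fin n`,
`Σ_{M : PMatch n} (Σ_{T : #{x∈T : partner x∈T} = 2κ} χ_{a,b}(T))² = 4^κ · pm(2κ) · pm(n−4κ) · Π_{i<κ}(n−2κ−2i)`.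
[cite: GodsilMeagher2015, §15.2] -/
theorem sum_sq_dipoleFunctional_closed (hn : Even n) (hκ : 4 * κ ≤ n) (ha : Function.Injective a)
    (hb : Function.Injective b) (hab : ∀ i j, a i ≠ b j) :
    ∑ M : PMatch n,
        (∑ T ∈ univ.filter (fun T : Finset (Fin n) => (T.filter fun x => M.2.partner x ∈ T).card = 2 * κ),
          dipoleVec (2 * κ) a b T) ^ 2 =
      (4 : ℝ) ^ κ * (pmCount (2 * κ) * pmCount (n - 4 * κ) * ∏ i ∈ range κ, ((n : ℝ) - 2 * κ - 2 * i)) := by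
  rw [sum_sq_dipoleFunctional ha hb hab, sum_even_block_pmCount_eq hn hκ, pow_mul]
  norm_num

end Summit.PneNP.PneNP.Theorems.ChebyshevTracialDesignDipoleNormClosedForm
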